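import Summits.BirchSwinnertonDyer.BirchSwinnertonDyer.Theorems.DerivedCoinvariantProfile

/-!
# The derived coinvariant profile, II: the defect law `ℓ_{(T)}(X) - e_1(X) = ∑_{i ≥ 2} e_i(X)` and
# its reading at a point `(E, p)` — helper

Sequel to `DerivedCoinvariantProfile` (cell `bsd-rank2`, seat p2, GEN 69; `--supports` the open leaf
`DepletedLambdaLawAtTwoModNSF` of route `EisensteinDepletionAtTwo`). Notation as there:
`e_{i+1}(X) = derivedLength X i = ℓ_{(T)}(T^iX/T^{i+1}X)`; `e_r(X(E/ℚ_∞)) = dim_{ℚ_p} S_p^{(r)}(E/ℚ)`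
is the domain of the `r`-th derived `p`-adic height [Howard2004DerivedHeights, Thm. 5.2].

## Results (all sorry-free)

§5 **defect law** `ℓ_{(T)}(X) = e_1 + ∑_{i ≥ 2} e_i` (`lengthAt_eq_derivedLength_zero_add_sum`);
`ℓ_{(T)}(X) = rank X/TX ⟺ e_2(X) = 0 ⟺ ker T² = ker T on ℚ_p ⊗ X` (the tree's leg (SS)).
§6 `ℓ = e_1 + 1 ⟺ (e_2, e_3) = (1, 0)`; §6b with Howard's parity at `r = 2` (even number of blocks
`Λ/(T²)`, Cor. 5.3, a HYPOTHESIS `∃ m, e_2 = e_3 + 2m`): `ℓ ≠ e_1 + 1`, and `e_1 = 2 ⇒ ℓ ∈ {2} ∪ [4,∞)`.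
§7 at a point `(E, p, f, κ, γ, D)` under (KD), (CT) [and (MC_T)]:
**`rank E(ℚ) + corank Ш(E/ℚ)[p^∞] + ∑_{i ≥ 2} e_i(X(E/ℚ_∞)) ≤ ord_{T=0} L_p(E,T)`**
(`rank_add_shaCorank_add_sum_derivedLength_le_order`); under (MC_T) the defect `ord_T L_p - rank` is
EXACTLY `corank Ш[p^∞] + ∑_{i ≥ 2} e_i`; the three legs with (SS) replaced by `e_2(X) = 0`; at Selmer
corank `2`, `ord_T L_p ∈ {2} ∪ [4, ∞)` given (MC_T) and Howard's parity at `r = 2`.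

## The door it types (Barrier-B1 honesty)

No motion on S0 is claimed: equality `ord_T L_p = rank` on an infinite rank-2 class still needs
`corank Ш[p^∞] = 0` there (barrier B1) — the identity only LOCATES the defect. The typed "extra input"
beyond (Ш) and (MC_T) is `e_2(X(E/ℚ_∞)) = 0`, i.e. NON-DEGENERACY OF THE FIRST DERIVED (= classical
cyclotomic `p`-adic) HEIGHT on `S_p^{(1)}` (Howard Cor. 5.3 first bullet; Schneider), and the finer
inputs `e_i = 0`, `i ≥ 3`; Howard: "it is not known that `e_i = 0` for `i > 1`". The higher `p`-adic
Gross–Zagier / derived Rubin formula (Howard Thm. 5.5: `h^{(r)}(z_0, c) = λ_z^{(r)}(c_p)` for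
`loc_s z ∈ J^r`) is the analytic partner and is NOT typed here. Door for the next GEN: the named
Literature fact "for `p` odd good ordinary, `∀ j, ∃ m, e_{2j+2}(X(E/ℚ_∞)) = e_{2j+3}(X(E/ℚ_∞)) + 2m`"
[Howard2004DerivedHeights, Cor. 5.3], which needs part I's definitions promoted to
`Literature/NumberTheory/EllipticCurves/`.

References: [BertoliniDarmon1995] Amer. J. Math. 117 (1995), §2; [Howard2004DerivedHeights]
Amer. J. Math. 126 (2004) (arXiv:1202.6343), Thm. 5.2, Cor. 5.3, Thm. 5.5; [GreenbergLNM1716] Thm. 1.2,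
§1 p. 65, Prop. 3.10; [Kato2004Asterisque] Astérisque 295, Thm. 17.4; [Washington1997] §13.2.
-/

-- D-0017: single-problem summit, so `Summit.BirchSwinnertonDyer.BirchSwinnertonDyer.…` repeats a
-- namespace BY DESIGN.
set_option linter.dupNamespace false

noncomputable section
open scoped BigOperators
universe u

namespace Summit.BirchSwinnertonDyer.BirchSwinnertonDyer.Theorems.DerivedCoinvariantProfileAtPoint

open Literature.NumberTheory.EllipticCurves Literature.NumberTheory.EllipticCurves.IwasawaAlgebra
open Summit.BirchSwinnertonDyer.BirchSwinnertonDyer.Theorems.DerivedCoinvariantProfile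

variable (p : ℕ) [Fact p.Prime]
variable (M : Type u) [AddCommGroup M] [Module (IwasawaAlgebra p) M]

/-! ## §5 The defect law and the semisimplicity criterion `ℓ_{(T)}(X) = e_1(X) ⟺ e_2(X) = 0` -/

variable {M} in
/-- **Defect law**: `ℓ_{(T)}(X) = e_1(X) + ∑_{1 ≤ i < n} e_{i+1}(X)` for `n ≥ max(1, ord_T a)`
(`a ≠ 0` an annihilator): the excess of the multiplicity of `(T)` over the coinvariant rank is the
mass of the HIGHER derived coinvariant lengths. [cite: BertoliniDarmon1995, §2] [cite: Howard2004DerivedHeights, Thm. 5.2 and Cor. 5.3] -/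
theorem lengthAt_eq_derivedLength_zero_add_sum {a : IwasawaAlgebra p} (ha0 : a ≠ 0)
    (ha : ∀ x : M, a • x = 0) {n : ℕ} (hn : a.order.toNat ≤ n) (hn1 : 1 ≤ n) :
    Module.lengthAt (IwasawaAlgebra p) M (primeT p) =
      derivedLength p M 0 + ∑ i ∈ Finset.Ico 1 n, derivedLength p M i := by
  rw [lengthAt_eq_sum_derivedLength p ha0 ha hn, Finset.range_eq_Ico,
    Finset.sum_eq_sum_Ico_succ_bot hn1]

/-- **Semisimplicity criterion.** For a finitely generated torsion `Λ`-module `X`: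
`ℓ_{(T)}(X) = rank_{ℤ_p} X/TX` **iff** `e_2(X) = 0` (`T X / T² X` is finite), i.e. iff the
`(T)`-primary part of `X` is killed by `T` up to pseudo-isomorphism — the module-theoretic form of
"the first derived `p`-adic height is non-degenerate iff there are no higher derived contributions".
The tree's `order_charGenerator_eq_coinvariantsRank_iff` is the same dichotomy spelled
`ker T² = ker T` on `ℚ_p ⊗ X`; here it is read off the profile law and monotonicity.
[cite: GreenbergLNM1716, §1 p. 65 (after Conj. 1.12)] [cite: BertoliniDarmon1995, §2] -/
theorem lengthAt_eq_coinvariantsRank_iff_derivedLength_one_eq_zero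
    [Module.Finite (IwasawaAlgebra p) M] (hM : Module.IsTorsion (IwasawaAlgebra p) M) :
    Module.lengthAt (IwasawaAlgebra p) M (primeT p) = (coinvariantsRank p M : ℕ∞) ↔
      derivedLength p M 1 = 0 := by
  obtain ⟨n₀, h⟩ := exists_lengthAt_eq_sum_derivedLength p M hM
  obtain ⟨hsum, -⟩ := h (n₀ + 2) (by omega)
  rw [Finset.sum_range_succ', Finset.sum_range_succ', derivedLength_zero_eq_coinvariantsRank,
    Nat.zero_add] at hsum
  rw [hsum]
  constructor
  · intro heq
    have hle : (∑ i ∈ Finset.range n₀, derivedLength p M (i + 1 + 1)) + derivedLength p M 1 +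
        (coinvariantsRank p M : ℕ∞) ≤ 0 + (coinvariantsRank p M : ℕ∞) := by
      rw [zero_add]
      exact heq.le
    have h1 := (ENat.add_le_add_iff_right (ENat.coe_ne_top _)).mp hle
    exact nonpos_iff_eq_zero.mp (le_add_self.trans h1)
  · intro h1
    rw [h1, add_zero, Finset.sum_eq_zero fun i _ ↦
      derivedLength_eq_zero_of_eq_zero p (by omega : 1 ≤ i + 1 + 1) h1, zero_add]

/-- **The same criterion against the tree's spelling**: for a finitely generated torsion `X`,
`e_2(X) = 0` iff `ker T² = ker T` on `ℚ_p ⊗_{ℤ_p} X` (`mulTRat`), via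
`order_charGenerator_eq_coinvariantsRank_iff` and `ord_T(char X) = ℓ_{(T)}(X)`.
[cite: GreenbergLNM1716, §1 p. 65 (after Conj. 1.12)] -/
theorem derivedLength_one_eq_zero_iff_ker_mulTRat_sq_eq
    [Module.Finite (IwasawaAlgebra p) M] (hM : Module.IsTorsion (IwasawaAlgebra p) M) :
    derivedLength p M 1 = 0 ↔
      LinearMap.ker (mulTRat p M ∘ₗ mulTRat p M) = LinearMap.ker (mulTRat p M) := by
  haveI : (Module.charIdeal (IwasawaAlgebra p) M).IsPrincipal := charIdeal_isPrincipal_holds p M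
  have hf : Module.charIdeal (IwasawaAlgebra p) M =
      Ideal.span {Submodule.IsPrincipal.generator (Module.charIdeal (IwasawaAlgebra p) M)} :=
    (Ideal.span_singleton_generator _).symm
  rw [← lengthAt_eq_coinvariantsRank_iff_derivedLength_one_eq_zero p M hM,
    ← order_charGenerator_eq_coinvariantsRank_iff p hM _ hf,
    order_eq_toNat_lengthAt p hM _ hf (primeT p) (primeT_asIdeal p),
    ENat.coe_toNat (lengthAt_primeT_ne_top M hM)]

/-! ## §6 The profile at small excess: `ℓ = e_1`, `ℓ = e_1 + 1` (the rank-2 values `2`, `3`, `≥ 4`) -/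

/-- `ℓ_{(T)}(X) = e_1(X)` iff `e_2(X) = 0` (finitely generated torsion `X`). With `e_1 = 2` (Selmer
corank `2` under control): `ℓ_{(T)}(X) = 2 ⟺ e_2(X) = 0`. [cite: BertoliniDarmon1995, §2]
[cite: GreenbergLNM1716, §1 p. 65] -/
theorem lengthAt_eq_derivedLength_zero_iff [Module.Finite (IwasawaAlgebra p) M]
    (hM : Module.IsTorsion (IwasawaAlgebra p) M) :
    Module.lengthAt (IwasawaAlgebra p) M (primeT p) = derivedLength p M 0 ↔
      derivedLength p M 1 = 0 := by
  rw [derivedLength_zero_eq_coinvariantsRank,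
    lengthAt_eq_coinvariantsRank_iff_derivedLength_one_eq_zero p M hM]

/-- **A degenerate derived direction costs an extra zero**: if `e_2(X) ≠ 0` then
`e_1(X) + 1 ≤ ℓ_{(T)}(X)`. [cite: BertoliniDarmon1995, §2] -/
theorem derivedLength_zero_add_one_le_lengthAt (h1 : derivedLength p M 1 ≠ 0) :
    derivedLength p M 0 + 1 ≤ Module.lengthAt (IwasawaAlgebra p) M (primeT p) := by
  refine le_trans ?_ (sum_derivedLength_le p M 2)
  rw [Finset.sum_range_succ, Finset.sum_range_one]
  exact add_le_add le_rfl (Order.one_le_iff_ne_zero.mpr h1)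

/-- **The next value**: for a finitely generated torsion `X`, `ℓ_{(T)}(X) = e_1(X) + 1` iff
`e_2(X) = 1 ∧ e_3(X) = 0` (one Jordan block of `T` of length exactly `2`, all others of length `1`, at
`(T)`). With `e_1 = 2`: `ℓ_{(T)}(X) = 3 ⟺ (e_2, e_3) = (1, 0)`; and `ℓ_{(T)}(X) ≥ 4` iff `e_2 = 2` or
`(e_2, e_3) = (1, ≥ 1)`. [cite: BertoliniDarmon1995, §2] [cite: Washington1997, §13.2] -/
theorem lengthAt_eq_derivedLength_zero_add_one_iff [Module.Finite (IwasawaAlgebra p) M]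
    (hM : Module.IsTorsion (IwasawaAlgebra p) M) :
    Module.lengthAt (IwasawaAlgebra p) M (primeT p) = derivedLength p M 0 + 1 ↔
      derivedLength p M 1 = 1 ∧ derivedLength p M 2 = 0 := by
  obtain ⟨n₀, h⟩ := exists_lengthAt_eq_sum_derivedLength p M hM
  obtain ⟨hsum, -⟩ := h (n₀ + 3) (by omega)
  rw [Finset.range_eq_Ico, Finset.sum_eq_sum_Ico_succ_bot (by omega : 0 < n₀ + 3),
    Finset.sum_eq_sum_Ico_succ_bot (by omega : 0 + 1 < n₀ + 3),
    Finset.sum_eq_sum_Ico_succ_bot (by omega : 0 + 1 + 1 < n₀ + 3)] at hsum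
  simp only [Nat.zero_add, Nat.reduceAdd] at hsum
  -- `hsum : ℓ = e 0 + (e 1 + (e 2 + S))`, `S = ∑_{3 ≤ i < n₀+3} e i`
  have hℓ : Module.lengthAt (IwasawaAlgebra p) M (primeT p) ≠ ⊤ := lengthAt_primeT_ne_top M hM
  have hfin : ∀ i, derivedLength p M i ≠ ⊤ := fun i ↦
    ne_top_of_le_ne_top hℓ (derivedLength_le_lengthAt p M i)
  have hS : ∑ i ∈ Finset.Ico 3 (n₀ + 3), derivedLength p M i ≠ ⊤ := by
    refine ne_top_of_le_ne_top hℓ ?_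
    rw [hsum, ← add_assoc, ← add_assoc]
    exact le_add_self
  have h21 : derivedLength p M 2 ≤ derivedLength p M 1 := derivedLength_succ_le p M 1
  have hS0 : derivedLength p M 2 = 0 → ∑ i ∈ Finset.Ico 3 (n₀ + 3), derivedLength p M i = 0 :=
    fun h2 ↦ sum_Ico_derivedLength_eq_zero p (derivedLength_eq_zero_of_eq_zero p (by omega) h2)
  obtain ⟨k0, hk0⟩ := ENat.ne_top_iff_exists.mp (hfin 0)
  obtain ⟨k1, hk1⟩ := ENat.ne_top_iff_exists.mp (hfin 1)
  obtain ⟨k2, hk2⟩ := ENat.ne_top_iff_exists.mp (hfin 2)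
  obtain ⟨kS, hkS⟩ := ENat.ne_top_iff_exists.mp hS
  rw [← hk0, ← hk1, ← hk2, ← hkS] at hsum
  rw [← hk1, ← hk2] at h21
  rw [← hk2, ← hkS] at hS0
  rw [hsum, ← hk0, ← hk1, ← hk2]
  have h21' : k2 ≤ k1 := by exact_mod_cast h21
  have hS0' : k2 = 0 → kS = 0 := fun h ↦ by exact_mod_cast hS0 (by exact_mod_cast h)
  constructor
  · intro heq
    have heq' : k0 + (k1 + (k2 + kS)) = k0 + 1 := by exact_mod_cast heq
    rcases Nat.eq_zero_or_pos k2 with h2 | h2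
    · have := hS0' h2
      exact ⟨by exact_mod_cast (show k1 = 1 by omega), by exact_mod_cast h2⟩
    · exfalso
      omega
  · rintro ⟨h1, h2⟩
    have h1' : k1 = 1 := by exact_mod_cast h1
    have h2' : k2 = 0 := by exact_mod_cast h2
    have := hS0' h2'
    exact_mod_cast (show k0 + (k1 + (k2 + kS)) = k0 + 1 by omega)

/-! ## §6b The alternating input: Howard's "`e_r ≡ 0 (mod 2)` for `r` even"

[Howard2004DerivedHeights, Thm. 5.2 + Cor. 5.3]: for `A/F` good ordinary above `p` and a
`ℤ_p`-extension `F_∞/F` with the bad primes finitely decomposed, `h^{(r)}` on `S_p^{(r)}(A/F)`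
(`dim = rank_{ℤ_p} J^{r-1}X/J^rX = e_r(X)`) is ALTERNATING for `r` even, so the number of blocks
`Λ/J^r` in `X_{(J)}` is EVEN for even `r`. We use the case `r = 2` as a HYPOTHESIS `∃ m, e_2 = e_3 + 2m`
(to be discharged for `X(E/ℚ_∞)` by a named Literature fact — NOT proved or stated as a fact here).
Howard, loc. cit.: "When `F = ℚ` and `A` is modular it is known by the work of Kato that `e_∞ = 0`
…, but it is not known that `e_i = 0` for `i > 1`."
-/

/-- **No single block of length two**: under Howard's parity constraint, `ℓ_{(T)}(X) ≠ e_1(X) + 1`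
for a finitely generated torsion `X` (the value `e_1 + 1` needs the profile `(e_1, 1, 0, …)`, i.e.
exactly one block `Λ/(T²)`, of odd multiplicity `1`). The hypothesis `hH` — "the number
`e_2(X) - e_3(X)` of blocks `Λ/(T²)` in `X_{(T)}` is even" — is the case `r = 2` of Howard's parity
constraint (`e_r^{How} ≡ 0 (mod 2)` for `r` even, from the ALTERNATING even derived heights); for
`X = X(E/ℚ_∞)`, `p` odd good ordinary, it is [Howard2004DerivedHeights, Cor. 5.3] and enters here as a
HYPOTHESIS (the named Literature fact is not yet typed). [cite: Howard2004DerivedHeights, Thm. 5.2, Cor. 5.3]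
[cite: BertoliniDarmon1995, §2] -/
theorem lengthAt_ne_derivedLength_zero_add_one_of_even_blocks_two
    [Module.Finite (IwasawaAlgebra p) M] (hM : Module.IsTorsion (IwasawaAlgebra p) M)
    (hH : ∃ m : ℕ, derivedLength p M 1 = derivedLength p M 2 + 2 * (m : ℕ∞)) :
    Module.lengthAt (IwasawaAlgebra p) M (primeT p) ≠ derivedLength p M 0 + 1 := by
  intro h
  obtain ⟨h1, h2⟩ := (lengthAt_eq_derivedLength_zero_add_one_iff p M hM).mp h
  obtain ⟨m, hm⟩ := hH
  rw [h1, h2, zero_add] at hm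
  have hm' : (1 : ℕ) = 2 * m := by exact_mod_cast hm
  omega

/-- **The corank-2 dichotomy under Howard's parity.** If `e_1(X) = 2` (Selmer corank `2` under
control) and `X` (finitely generated, torsion) has an even number of blocks `Λ/(T²)` at `(T)`
(Howard's parity constraint at `r = 2`), then `ℓ_{(T)}(X) = 2` or `ℓ_{(T)}(X) ≥ 4` — the
multiplicity of `(T)` in `char X(E/ℚ_∞)` is never `3` at Selmer corank `2`; `ℓ = 2` iff `e_2(X) = 0`
(`lengthAt_eq_derivedLength_zero_iff`).
[cite: Howard2004DerivedHeights, Cor. 5.3] [cite: GreenbergLNM1716, §1 p. 65 and Prop. 3.10] -/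
theorem lengthAt_eq_two_or_four_le_of_even_blocks_two
    [Module.Finite (IwasawaAlgebra p) M] (hM : Module.IsTorsion (IwasawaAlgebra p) M)
    (hH : ∃ m : ℕ, derivedLength p M 1 = derivedLength p M 2 + 2 * (m : ℕ∞))
    (h2 : derivedLength p M 0 = 2) :
    Module.lengthAt (IwasawaAlgebra p) M (primeT p) = 2 ∨
      4 ≤ Module.lengthAt (IwasawaAlgebra p) M (primeT p) := by
  have hne := lengthAt_ne_derivedLength_zero_add_one_of_even_blocks_two p M hM hH
  have hge : derivedLength p M 0 ≤ Module.lengthAt (IwasawaAlgebra p) M (primeT p) :=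
    derivedLength_le_lengthAt p M 0
  rw [h2] at hne hge
  obtain ⟨k, hk⟩ := ENat.ne_top_iff_exists.mp (lengthAt_primeT_ne_top M hM)
  rw [← hk] at hne hge ⊢
  have hge' : 2 ≤ k := by exact_mod_cast hge
  have hne' : k ≠ 3 := fun h ↦ hne (by rw [h]; rfl)
  rcases (show k = 2 ∨ 4 ≤ k by omega) with h | h
  · exact Or.inl (by exact_mod_cast h)
  · exact Or.inr (by exact_mod_cast h)

/-! ## §7 At a point `(E, p)`: the derived reading of `ord_{T=0} L_p(E,T) - rank E(ℚ)`

Setting of `PAdicOrderV2PadicBSDrankExact`: `E/ℚ` with globally minimal model `W`, a prime `p`, a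
weight-2 cusp form `f`, `L_p = padicLFunction f (unitRoot W p)`, the cyclotomic `κ` with topological
generator `γ`, a dual datum `D` with `X = D.X = X(E/ℚ_∞)`; (KD) = the shape of clauses 1–2 of the tree
fact `kato_divisibility` (Kato Thm. 17.4); (CT) = the corank form of Mazur control at the point.
-/

section Arithmetic

open scoped MatrixGroups ModularForm
open CongruenceSubgroup

variable (W : WeierstrassCurve ℚ) [W.IsElliptic] [W.IsGloballyMinimal]
  {N : ℕ} (f : CuspForm (Gamma0 N) 2)
  {κ : ZpExtension ℚ p} {γ : Field.absoluteGaloisGroup ℚ}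

omit [W.IsElliptic] in
/-- (KD) gives `ℓ_{(T)}(X) ≤ ord_{T=0} L_p`: `ℓ_{(T)}(X) ≤ ord_T g ≤ ord_T ι(g) = ord_T (p^n L_p) =
ord_T L_p`. [cite: Kato2004Asterisque, Thm. 17.4 (p. 273)] -/
theorem lengthAt_le_order_padicLFunction_of_KD (D : W.SelmerDualData κ γ)
    [Module.Finite (IwasawaAlgebra p) D.X] (htors : D.IsTorsion)
    (hKD : ∃ (n : ℕ) (g : IwasawaAlgebra p), g ∈ D.charIdeal ∧
      iwasawaToPowerSeries p g =
        PowerSeries.C ((p : ℚ_[p]) ^ n) * padicLFunction f (unitRoot W p : ℚ_[p])) :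
    Module.lengthAt (IwasawaAlgebra p) D.X (primeT p) ≤
      (padicLFunction f (unitRoot W p : ℚ_[p])).order := by
  obtain ⟨n, g, hg, hι⟩ := hKD
  have hpn : IsUnit (PowerSeries.C ((p : ℚ_[p]) ^ n)) := by
    refine IsUnit.map PowerSeries.C (IsUnit.pow n (IsUnit.mk0 _ ?_))
    exact_mod_cast (Fact.out : p.Prime).ne_zero
  have h3 : (iwasawaToPowerSeries p g).order = (padicLFunction f (unitRoot W p : ℚ_[p])).order := by
    rw [hι, PowerSeries.order_mul, PowerSeries.order_zero_of_unit hpn, zero_add]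
  exact (lengthAt_primeT_le_order D.X htors g hg).trans
    ((PowerSeries.le_order_map _).trans h3.le)

/-- **Derived excess-zero inequality at a point.** Under (KD) and (CT):
`rank E(ℚ) + corank_{ℤ_p} Ш(E/ℚ)[p^∞] + ∑_{1 ≤ i < n} e_{i+1}(X) ≤ ord_{T=0} L_p(E,T)` for every `n`:
beyond the Mordell–Weil rank, the order of vanishing of the `p`-adic `L`-function at `T = 0` is
bounded BELOW by the `p`-Шafarevich corank PLUS the whole higher derived coinvariant profile of
`X(E/ℚ_∞)` (each degenerate derived direction forces an extra zero). Inputs: the profile law (§2),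
`e_1(X) = rank X/TX` (§3), the Kummer identity `corank Sel = rank + corank Ш`
(`selmerCorank_eq_mordellWeilRank_add_holds`). This refines the tree's `rank ≤ corank Sel ≤ ord_T L_p`
(Kato Thm. 18.4 via `kato_selmerCorank_le_order_padicLFunction_of_data`).
[cite: Kato2004Asterisque, Thm. 17.4 and Thm. 18.4] [cite: BertoliniDarmon1995, §2]
[cite: GreenbergLNM1716, Thm. 1.2 and §1 p. 65] -/
theorem rank_add_shaCorank_add_sum_derivedLength_le_order
    (hκ : κ.IsCyclotomic) (hγ : κ.IsTopGenerator γ) (D : W.SelmerDualData κ γ)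
    (htors : D.IsTorsion)
    (hKD : ∃ (n : ℕ) (g : IwasawaAlgebra p), g ∈ D.charIdeal ∧
      iwasawaToPowerSeries p g =
        PowerSeries.C ((p : ℚ_[p]) ^ n) * padicLFunction f (unitRoot W p : ℚ_[p]))
    (hctrl : coinvariantsRank p D.X = W.selmerCorank p) (n : ℕ) :
    (W.mordellWeilRank : ℕ∞) + W.shaCorank p + ∑ i ∈ Finset.Ico 1 (n + 1), derivedLength p D.X i ≤
      (padicLFunction f (unitRoot W p : ℚ_[p])).order := by
  haveI : Module.Finite (IwasawaAlgebra p) D.X := D.module_finite_of_isCyclotomic W κ hκ hγ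
  have hid : W.selmerCorank p = W.mordellWeilRank + W.shaCorank p :=
    W.selmerCorank_eq_mordellWeilRank_add_holds p
  have hsum : ∑ i ∈ Finset.range (n + 1), derivedLength p D.X i =
      (W.mordellWeilRank : ℕ∞) + W.shaCorank p +
        ∑ i ∈ Finset.Ico 1 (n + 1), derivedLength p D.X i := by
    rw [Finset.range_eq_Ico, Finset.sum_eq_sum_Ico_succ_bot (Nat.succ_pos n),
      derivedLength_zero_eq_coinvariantsRank, hctrl, hid, Nat.cast_add]
  rw [← hsum]
  exact (sum_derivedLength_le p D.X (n + 1)).trans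
    (lengthAt_le_order_padicLFunction_of_KD p W f D htors hKD)

/-- **The exact defect decomposition under the main conjecture at `(T)`.** Under (KD), (CT) and
(MC_T) `ℓ_{(T)}(X) = ord_{T=0} L_p`: for all large `n`,
`ord_{T=0} L_p(E,T) = rank E(ℚ) + corank_{ℤ_p} Ш(E/ℚ)[p^∞] + ∑_{1 ≤ i < n} e_{i+1}(X(E/ℚ_∞))`,
and the profile is eventually `0`. So the defect `ord_T L_p - rank E(ℚ)` of `p`-adic BSD (rank part)
is EXACTLY `corank Ш[p^∞]` plus the higher derived coinvariant lengths — the algebraic side of the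
Bertolini–Darmon derived-height formula `ord = ∑_k rank S^{(k)}`.
[cite: BertoliniDarmon1995, §2] [cite: Kato2004Asterisque, Thm. 17.4]
[cite: GreenbergLNM1716, Thm. 1.2 and §1 p. 65] -/
theorem order_eq_rank_add_shaCorank_add_sum_derivedLength_of_MCT
    (hκ : κ.IsCyclotomic) (hγ : κ.IsTopGenerator γ) (D : W.SelmerDualData κ γ)
    (htors : D.IsTorsion) (hctrl : coinvariantsRank p D.X = W.selmerCorank p)
    (hMCT : Module.lengthAt (IwasawaAlgebra p) D.X (primeT p) =
      (padicLFunction f (unitRoot W p : ℚ_[p])).order) :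
    ∃ n₀ : ℕ, ∀ n, n₀ ≤ n →
      (padicLFunction f (unitRoot W p : ℚ_[p])).order =
          (W.mordellWeilRank : ℕ∞) + W.shaCorank p +
            ∑ i ∈ Finset.Ico 1 (n + 1), derivedLength p D.X i ∧
        derivedLength p D.X (n + 1) = 0 := by
  haveI : Module.Finite (IwasawaAlgebra p) D.X := D.module_finite_of_isCyclotomic W κ hκ hγ
  have hid : W.selmerCorank p = W.mordellWeilRank + W.shaCorank p :=
    W.selmerCorank_eq_mordellWeilRank_add_holds p
  obtain ⟨n₀, h⟩ := exists_lengthAt_eq_sum_derivedLength p D.X htors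
  refine ⟨n₀, fun n hn ↦ ?_⟩
  obtain ⟨hsum, hzero⟩ := h (n + 1) (by omega)
  refine ⟨?_, hzero⟩
  rw [← hMCT, hsum, Finset.range_eq_Ico, Finset.sum_eq_sum_Ico_succ_bot (Nat.succ_pos n),
    derivedLength_zero_eq_coinvariantsRank, hctrl, hid, Nat.cast_add]

/-- **`p`-adic BSD (rank part) at a point, derived form: exactly three legs.** Under (KD) and (CT):
`ord_{T=0} L_p(E,T) = rank E(ℚ)` **iff** (MC_T) `ℓ_{(T)}(X) = ord_{T=0} L_p` **and** `e_2(X(E/ℚ_∞)) = 0`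
(no second derived coinvariant length: `TX/T²X` finite) **and** `corank_{ℤ_p} Ш(E/ℚ)[p^∞] = 0`.
This is the tree's `padicBSDrank_eq_at_point_iff_three_legs` with its semisimplicity leg (SS)
replaced by the first entry of the derived profile; for rank `2` the middle leg reads
"`e_2(X) = 0`, equivalently `ℓ_{(T)}(X) = 2`" given the outer legs.
[cite: Kato2004Asterisque, Thm. 17.4 (p. 273)] [cite: GreenbergLNM1716, §1 Conj. 1.12–1.13 and p. 65]
[cite: BertoliniDarmon1995, §2] -/
theorem order_eq_rank_iff_MCT_and_derivedLength_one_eq_zero_and_shaCorank_eq_zero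
    (hκ : κ.IsCyclotomic) (hγ : κ.IsTopGenerator γ) (D : W.SelmerDualData κ γ)
    (htors : D.IsTorsion)
    (hKD : ∃ (n : ℕ) (g : IwasawaAlgebra p), g ∈ D.charIdeal ∧
      iwasawaToPowerSeries p g =
        PowerSeries.C ((p : ℚ_[p]) ^ n) * padicLFunction f (unitRoot W p : ℚ_[p]))
    (hctrl : coinvariantsRank p D.X = W.selmerCorank p) :
    (padicLFunction f (unitRoot W p : ℚ_[p])).order = W.mordellWeilRank ↔
      Module.lengthAt (IwasawaAlgebra p) D.X (primeT p) =
          (padicLFunction f (unitRoot W p : ℚ_[p])).order ∧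
        derivedLength p D.X 1 = 0 ∧ W.shaCorank p = 0 := by
  haveI : Module.Finite (IwasawaAlgebra p) D.X := D.module_finite_of_isCyclotomic W κ hκ hγ
  have hid : W.selmerCorank p = W.mordellWeilRank + W.shaCorank p :=
    W.selmerCorank_eq_mordellWeilRank_add_holds p
  have hfin : Module.lengthAt (IwasawaAlgebra p) D.X (primeT p) ≠ ⊤ := lengthAt_primeT_ne_top D.X htors
  have hc1 : (coinvariantsRank p D.X : ℕ∞) ≤ Module.lengthAt (IwasawaAlgebra p) D.X (primeT p) :=
    coinvariantsRank_le_lengthAt_primeT D.X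
  have hc2 := lengthAt_le_order_padicLFunction_of_KD p W f D htors hKD
  have hcrit := lengthAt_eq_coinvariantsRank_iff_derivedLength_one_eq_zero p D.X htors
  obtain ⟨ℓ, hℓ⟩ := ENat.ne_top_iff_exists.mp hfin
  rw [← hℓ] at hc1 hc2 hcrit ⊢
  have hc1' : coinvariantsRank p D.X ≤ ℓ := by exact_mod_cast hc1
  constructor
  · intro hS
    rw [hS] at hc2 ⊢
    have hc2' : ℓ ≤ W.mordellWeilRank := by exact_mod_cast hc2
    have hℓeq : ℓ = coinvariantsRank p D.X := by omega
    refine ⟨by exact_mod_cast (show ℓ = W.mordellWeilRank by omega), ?_, by omega⟩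
    exact hcrit.mp (by exact_mod_cast hℓeq)
  · rintro ⟨hMCT, h1, hsha⟩
    have hℓc : (ℓ : ℕ∞) = coinvariantsRank p D.X := hcrit.mpr h1
    rw [← hMCT, hℓc, hctrl, hid, hsha, Nat.add_zero]

/-- **At a point, under Howard's parity: the defect is `0` or `≥ 2` beyond Ш.** Under (CT), (MC_T)
and Howard's parity constraint at `r = 2` for `X(E/ℚ_∞)` (an even number of blocks `Λ/(T²)`;
[Howard2004DerivedHeights, Cor. 5.3], a HYPOTHESIS here), if `corank Sel_{p^∞}(E/ℚ) = 2` then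
`ord_{T=0} L_p(E,T) = 2` or `ord_{T=0} L_p(E,T) ≥ 4`; with `rank E(ℚ) = 2` and `Ш[p^∞]` finite this
reads: `p`-adic BSD (rank part) holds at `p`, or fails by at least `2`. The analytic counterpart
(`ord_T L_p ≡ rank`, functional equation + `p`-parity) is print; this is the ALGEBRAIC-side law.
[cite: Howard2004DerivedHeights, Cor. 5.3] [cite: Kato2004Asterisque, Thm. 17.4] [cite: GreenbergLNM1716, Prop. 3.10] -/
theorem order_eq_two_or_four_le_of_MCT_of_even_blocks_two
    (hκ : κ.IsCyclotomic) (hγ : κ.IsTopGenerator γ) (D : W.SelmerDualData κ γ)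
    (htors : D.IsTorsion) (hctrl : coinvariantsRank p D.X = W.selmerCorank p)
    (hMCT : Module.lengthAt (IwasawaAlgebra p) D.X (primeT p) =
      (padicLFunction f (unitRoot W p : ℚ_[p])).order)
    (hH : ∃ m : ℕ, derivedLength p D.X 1 = derivedLength p D.X 2 + 2 * (m : ℕ∞))
    (hs : W.selmerCorank p = 2) :
    (padicLFunction f (unitRoot W p : ℚ_[p])).order = 2 ∨
      4 ≤ (padicLFunction f (unitRoot W p : ℚ_[p])).order := by
  haveI : Module.Finite (IwasawaAlgebra p) D.X := D.module_finite_of_isCyclotomic W κ hκ hγ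
  have h2 : derivedLength p D.X 0 = 2 := by
    rw [derivedLength_zero_eq_coinvariantsRank, hctrl, hs, Nat.cast_ofNat]
  rw [← hMCT]
  exact lengthAt_eq_two_or_four_le_of_even_blocks_two p D.X htors hH h2

end Arithmetic

end Summit.BirchSwinnertonDyer.BirchSwinnertonDyer.Theorems.DerivedCoinvariantProfileAtPoint
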